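import Literature.NumberTheory.Sieve.LinearEquationsInPrimesComplexityNormalForm
import Literature.NumberTheory.Sieve.LinearEquationsInPrimesCount
import Literature.NumberTheory.Sieve.LinearEquationsInPrimesLocalObstruction
import Literature.NumberTheory.Sieve.LinearEquationsInPrimesMultiplicativity
import Mathlib.MeasureTheory.Measure.Lebesgue.EqHaar
import HarnessLib

/-!
# Green–Tao 2010, Corollary 1.9 (qualitative generalised Hardy–Littlewood) at complexity `≤ s` — unconditional at complexity `≤ 1`

Topic `Literature/NumberTheory/Sieve`. Source: B. Green, T. Tao, *Linear equations in primes*,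
Ann. of Math. 171 (2010), 1753–1850 (arXiv:math/0606088), §1, Corollary 1.9: "Suppose that
`GI(s)` and `MN(s)` are true for some `s ≥ 1`. Let `Ψ = (ψ₁, …, ψ_t) : ℤ^d → ℤ^t` be a system of
complexity at most `s`, and let `K ⊂ ℝ^d` be an open convex cone. Suppose (i) for each prime `p`
there exists `n ∈ ℤ^d` such that `ψ₁(n), …, ψ_t(n)` are all coprime to `p`; (ii) there exists
`n ∈ K ∩ ℤ^d` such that `ψ̇₁(n), …, ψ̇_t(n) > 0`. Then there exist infinitely many `n ∈ K ∩ ℤ^d`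
such that `ψ₁(n), …, ψ_t(n)` are all prime."

We prove this with the hypothesis "`GI(s)` and `MN(s)`" replaced by the Main Theorem at
complexity `≤ s` itself (`GreenTao2010_mainTheoremAtComplexity s`, of which it is the printed
consequence), and hence UNCONDITIONALLY at complexity `≤ 1`
(`GreenTao2010_mainTheoremAtComplexity_one`, `LinearEquationsInPrimesComplexityNormalForm.lean`):

* `GreenTao2010_primePointCount_of_mainTheoremAtComplexity`,
  `GreenTao2010_primePointCountAtComplexity_one` — the prime-COUNTING asymptotic (1.8) for the
  class of systems of complexity `≤ s` (resp. `≤ 1`, unconditional), by the tree's class-general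
  deduction `primePointCount_asymptotic_of_vonMangoldtSum_asymptotic` (Conj. 1.2 ⇒ Conj. 1.4);
* `localFactor_pos_of_exists_not_dvd` — local solvability (i) at `p` gives `β_p > 0`, hence with
  the tree's `singularProduct_pos_of_localFactor_pos` (Lemma 1.3) `∏_p β_p > 0`;
* `archFactor_inter_realBox_ge_of_cone` — for an open cone `K` and a point of `K` at which all
  linear parts `ψ̇ᵢ` are positive, `β_∞(K ∩ [−N, N]^d) ≥ c N^d` for `N ≥ N₁` (a dilate `N · U` of a
  small open neighbourhood sits inside the positive body; Lebesgue measure scales by `N^d`,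
  [Mathlib: `MeasureTheory.Measure.addHaar_smul`]);
* `GreenTao2010_corollary19_of_mainTheoremAtComplexity` — Corollary 1.9 at complexity `≤ s` from
  the Main Theorem at complexity `≤ s`; `GreenTao2010_corollary19_atComplexity_one` —
  **unconditionally for every system of complexity `≤ 1`** (all `d, t ≥ 1`).

## References

* [GreenTao2010] B. Green, T. Tao, *Linear equations in primes*, Ann. of Math. (2) 171 (2010),
  1753–1850: Cor. 1.9, Conj. 1.4 / (1.8), Lemma 1.3, (1.4), (1.6).
-/

noncomputable section

open Finset Filter MeasureTheory
open scoped Topology Pointwise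

namespace Literature.NumberTheory.Sieve

variable {d t : ℕ}

/-! ### The prime-counting asymptotic at complexity `≤ s` -/

/-- **The counting form (1.8) at complexity `≤ s`, from the Main Theorem at complexity `≤ s`**:
uniformly over nondegenerate systems `Ψ` of complexity `≤ s` and size `‖Ψ‖_N ≤ L` and convex
`K ⊆ [−N, N]^d`,
`#{n ∈ K ∩ ℤ^d : ψᵢ(n) prime ∀ i} = (1 + o(1)) β_∞ ∏_p β_p / logᵗ N + o(N^d / logᵗ N)`.
[cite: GreenTao2010, Conj. 1.4 (sketch proof) and Main Theorem] -/
theorem GreenTao2010_primePointCount_of_mainTheoremAtComplexity {s : ℕ}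
    (h : GreenTao2010_mainTheoremAtComplexity s) :
    ∀ (d t L : ℕ), 1 ≤ d → 1 ≤ t → ∀ ε : ℝ, 0 < ε → ∃ N₀ : ℕ, ∀ N : ℕ, N₀ ≤ N →
      ∀ Ψ : Fin t → AffLinForm d, IsNondegenerateSystem Ψ → complexity Ψ ≤ s →
        affLinSize Ψ N ≤ L →
        ∀ K : Set (Fin d → ℝ), Convex ℝ K → K ⊆ realBox d N →
          |(primePointCount Ψ K N : ℝ) - archFactor Ψ K * singularProduct Ψ / Real.log N ^ t| ≤
            ε * (archFactor Ψ K * singularProduct Ψ + (N : ℝ) ^ d) / Real.log N ^ t :=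
  primePointCount_asymptotic_of_vonMangoldtSum_asymptotic (fun _ _ Ψ => complexity Ψ ≤ s) h

/-- **The counting form (1.8) for every system of complexity `≤ 1`, unconditionally.**
[cite: GreenTao2010, Conj. 1.4 (sketch proof) and Main Theorem (case `s = 1`)] -/
theorem GreenTao2010_primePointCountAtComplexity_one :
    ∀ (d t L : ℕ), 1 ≤ d → 1 ≤ t → ∀ ε : ℝ, 0 < ε → ∃ N₀ : ℕ, ∀ N : ℕ, N₀ ≤ N →
      ∀ Ψ : Fin t → AffLinForm d, IsNondegenerateSystem Ψ → complexity Ψ ≤ (1 : ℕ) →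
        affLinSize Ψ N ≤ L →
        ∀ K : Set (Fin d → ℝ), Convex ℝ K → K ⊆ realBox d N →
          |(primePointCount Ψ K N : ℝ) - archFactor Ψ K * singularProduct Ψ / Real.log N ^ t| ≤
            ε * (archFactor Ψ K * singularProduct Ψ + (N : ℝ) ^ d) / Real.log N ^ t :=
  GreenTao2010_primePointCount_of_mainTheoremAtComplexity GreenTao2010_mainTheoremAtComplexity_one

/-! ### Local solvability gives positive local factors -/

/-- **Local solvability at `p` gives `β_p > 0`**: if some `n ∈ ℤ^d` has all `ψᵢ(n)` coprime to
the prime `p`, then `β_p(Ψ) ≥ p^{-d} (p/(p−1))^t > 0` (the residue of `n` contributes).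
[cite: GreenTao2010, (1.6) and Cor. 1.9 (first bullet)] -/
theorem localFactor_pos_of_exists_not_dvd {Ψ : Fin t → AffLinForm d} {p : ℕ} (hp : p.Prime)
    (h : ∃ n : Fin d → ℤ, ∀ i, ¬ ((p : ℤ) ∣ (Ψ i).eval n)) : 0 < localFactor Ψ p := by
  haveI := Fact.mk hp
  obtain ⟨n, hn⟩ := h
  rw [localFactor_eq_sum_zmod]
  have hp0 : (0 : ℝ) < p := by exact_mod_cast hp.pos
  refine mul_pos (by positivity) ?_
  set v : Fin d → ZMod p := fun j => ((n j : ℤ) : ZMod p) with hv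
  refine lt_of_lt_of_le ?_ (Finset.single_le_sum
    (f := fun w : Fin d → ZMod p => ∏ i, localVonMangoldtZMod p ((Ψ i).modEval p w))
    (fun w _ => Finset.prod_nonneg fun i _ => localVonMangoldtZMod_nonneg _ _) (Finset.mem_univ v))
  refine Finset.prod_pos fun i _ => ?_
  have hne : (Ψ i).modEval p v ≠ 0 := by
    rw [hv, ← AffLinForm.intCast_eval, ne_eq, ZMod.intCast_zmod_eq_zero_iff_dvd]
    exact hn i
  unfold localVonMangoldtZMod
  rw [if_pos (isUnit_iff_ne_zero.mpr hne)]
  have h1 : (0 : ℝ) < (Nat.totient p : ℝ) := by exact_mod_cast Nat.totient_pos.2 hp.pos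
  exact div_pos hp0 h1

/-- **No local obstruction gives a positive singular product**: if for every prime `p` some
`n ∈ ℤ^d` has all `ψᵢ(n)` coprime to `p`, then `∏_p β_p > 0`.
[cite: GreenTao2010, Lemma 1.3 and Cor. 1.9] -/
theorem singularProduct_pos_of_locallySolvable (Ψ : Fin t → AffLinForm d)
    (hΨ : IsNondegenerateSystem Ψ)
    (hloc : ∀ p : ℕ, p.Prime → ∃ n : Fin d → ℤ, ∀ i, ¬ ((p : ℤ) ∣ (Ψ i).eval n)) :
    0 < singularProduct Ψ :=
  singularProduct_pos_of_localFactor_pos Ψ hΨ fun _ hp => localFactor_pos_of_exists_not_dvd hp (hloc _ hp)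

/-! ### The archimedean factor on a cone -/

/-- `ψ` is continuous on `ℝ^d`. [folklore] -/
private theorem AffLinForm.continuous_realEval (ψ : AffLinForm d) : Continuous ψ.realEval := by
  unfold AffLinForm.realEval
  exact (continuous_finsetSum _ fun j _ => continuous_const.mul (continuous_apply j)).add
    continuous_const

/-- The linear part is homogeneous: `ψ(r x) − ψ(0) = r (ψ(x) − ψ(0))`. [folklore] -/
private theorem AffLinForm.realEval_smul_sub_const (ψ : AffLinForm d) (r : ℝ) (x : Fin d → ℝ) :
    ψ.realEval (r • x) - ψ.const = r * (ψ.realEval x - ψ.const) := by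
  simp only [AffLinForm.realEval, Pi.smul_apply, smul_eq_mul, add_sub_cancel_right, Finset.mul_sum]
  exact Finset.sum_congr rfl fun j _ => by ring

/-- **`β_∞ ≫ N^d` on a cone.** Let `K ⊆ ℝ^d` be open and closed under positive dilations, and let
`x₀ ∈ K` be a point at which every linear part `ψ̇ᵢ` is positive. Then there are `c > 0` and `N₁`
with `β_∞(Ψ, K ∩ [−N, N]^d) ≥ c N^d` for all `N ≥ N₁`: a small open neighbourhood `U ∋ x₀/R`
inside `K ∩ (−1, 1)^d` on which `ψ̇ᵢ > ηᵢ > 0` has `N · U ⊆ K ∩ [−N, N]^d ∩ {ψᵢ > 0}` once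
`N ηᵢ > |ψᵢ(0)|`, and `vol(N · U) = N^d vol(U) > 0`. [cite: GreenTao2010, (1.4) and Cor. 1.9 (proof)] -/
theorem archFactor_inter_realBox_ge_of_cone (Ψ : Fin t → AffLinForm d) {K : Set (Fin d → ℝ)}
    (hKo : IsOpen K) (hcone : ∀ r : ℝ, 0 < r → ∀ x ∈ K, r • x ∈ K)
    {x₀ : Fin d → ℝ} (hx₀ : x₀ ∈ K) (hpos : ∀ i, (Ψ i).const < (Ψ i).realEval x₀) :
    ∃ c : ℝ, 0 < c ∧ ∃ N₁ : ℕ, 1 ≤ N₁ ∧ ∀ N : ℕ, N₁ ≤ N →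
      c * (N : ℝ) ^ d ≤ archFactor Ψ (K ∩ realBox d N) := by
  -- normalise `x₀` into the open unit cube
  set R : ℝ := 1 + ∑ j, |x₀ j| with hR
  have hR0 : 0 < R := by
    have := Finset.sum_nonneg fun j (_ : j ∈ (univ : Finset (Fin d))) => abs_nonneg (x₀ j)
    linarith
  set y₀ : Fin d → ℝ := R⁻¹ • x₀ with hy₀
  have hy₀K : y₀ ∈ K := hcone _ (inv_pos.mpr hR0) x₀ hx₀
  have hy₀abs : ∀ j, |y₀ j| < 1 := by
    intro j
    have h1 : |x₀ j| ≤ ∑ j, |x₀ j| :=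
      Finset.single_le_sum (f := fun j => |x₀ j|) (fun _ _ => abs_nonneg _) (mem_univ j)
    have h2 : |y₀ j| = R⁻¹ * |x₀ j| := by
      simp only [hy₀, Pi.smul_apply, smul_eq_mul, abs_mul, abs_inv, abs_of_pos hR0]
    rw [h2, inv_mul_lt_iff₀ hR0]
    linarith
  -- positive lower bounds `ηᵢ` for the linear parts near `y₀`
  set η : Fin t → ℝ := fun i => R⁻¹ * ((Ψ i).realEval x₀ - (Ψ i).const) / 2 with hη
  have hη0 : ∀ i, 0 < η i := fun i =>
    div_pos (mul_pos (inv_pos.mpr hR0) (sub_pos.mpr (hpos i))) two_pos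
  have hy₀lin : ∀ i, (Ψ i).realEval y₀ - (Ψ i).const = R⁻¹ * ((Ψ i).realEval x₀ - (Ψ i).const) :=
    fun i => (Ψ i).realEval_smul_sub_const _ _
  -- the open set `U`
  set U : Set (Fin d → ℝ) :=
    (K ∩ {x | ∀ j, |x j| < 1}) ∩ {x | ∀ i, η i < (Ψ i).realEval x - (Ψ i).const} with hU
  have hUo : IsOpen U := by
    refine (hKo.inter ?_).inter ?_
    · have : {x : Fin d → ℝ | ∀ j, |x j| < 1} = ⋂ j, {x | |x j| < 1} := by ext; simp
      rw [this]
      exact isOpen_iInter_of_finite fun j => isOpen_lt (continuous_apply j).abs continuous_const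
    · have : {x : Fin d → ℝ | ∀ i, η i < (Ψ i).realEval x - (Ψ i).const} =
          ⋂ i, {x | η i < (Ψ i).realEval x - (Ψ i).const} := by ext; simp
      rw [this]
      exact isOpen_iInter_of_finite fun i =>
        isOpen_lt continuous_const ((Ψ i).continuous_realEval.sub continuous_const)
  have hy₀U : y₀ ∈ U := by
    refine ⟨⟨hy₀K, hy₀abs⟩, fun i => ?_⟩
    show η i < (Ψ i).realEval y₀ - (Ψ i).const
    rw [hy₀lin]
    have := mul_pos (inv_pos.mpr hR0) (sub_pos.mpr (hpos i))
    simp only [hη]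
    linarith
  have hUpos : 0 < volume U := hUo.measure_pos volume ⟨y₀, hy₀U⟩
  have hUfin : volume U < ⊤ := by
    refine lt_of_le_of_lt (measure_mono ?_)
      (measure_Icc_lt_top (a := fun _ : Fin d => (-1 : ℝ)) (b := fun _ => 1))
    intro x hx
    exact ⟨fun j => (abs_lt.mp (hx.1.2 j)).1.le, fun j => (abs_lt.mp (hx.1.2 j)).2.le⟩
  refine ⟨(volume U).toReal, ENNReal.toReal_pos hUpos.ne' hUfin.ne, ?_⟩
  -- the threshold `N₁`
  refine ⟨⌈∑ i, |((Ψ i).const : ℝ)| / η i⌉₊ + 1, by omega, fun N hN => ?_⟩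
  have hN1 : (1 : ℝ) ≤ N := by exact_mod_cast (show 1 ≤ N by omega)
  have hN0 : (0 : ℝ) < N := by linarith
  have hNi : ∀ i, |((Ψ i).const : ℝ)| < η i * N := by
    intro i
    have h1 : |((Ψ i).const : ℝ)| / η i ≤ ∑ i, |((Ψ i).const : ℝ)| / η i :=
      Finset.single_le_sum (f := fun i => |((Ψ i).const : ℝ)| / η i)
        (fun i _ => div_nonneg (abs_nonneg _) (hη0 i).le) (mem_univ i)
    have h2 : (∑ i, |((Ψ i).const : ℝ)| / η i) < N := by
      have h3 := Nat.le_ceil (∑ i, |((Ψ i).const : ℝ)| / η i)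
      have h4 : ((⌈∑ i, |((Ψ i).const : ℝ)| / η i⌉₊ : ℕ) : ℝ) + 1 ≤ N := by exact_mod_cast hN
      linarith
    have h5 := (div_lt_iff₀ (hη0 i)).mp (lt_of_le_of_lt h1 h2)
    linarith
  -- `N · U` sits inside the positive body of `K ∩ [−N, N]^d`
  have hsub : (N : ℝ) • U ⊆ (K ∩ realBox d N) ∩ {x | ∀ i, 0 < (Ψ i).realEval x} := by
    rintro _ ⟨x, hx, rfl⟩
    obtain ⟨⟨hxK, hxabs⟩, hxlin⟩ := hx
    refine ⟨⟨hcone _ hN0 x hxK, ?_⟩, fun i => ?_⟩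
    · unfold realBox
      simp only [Set.mem_Icc]
      refine ⟨fun j => ?_, fun j => ?_⟩
      · have := (abs_lt.mp (hxabs j)).1
        simp only [Pi.smul_apply, smul_eq_mul]
        nlinarith
      · have := (abs_lt.mp (hxabs j)).2
        simp only [Pi.smul_apply, smul_eq_mul]
        nlinarith
    · have h1 : (Ψ i).realEval ((N : ℝ) • x) - (Ψ i).const =
          N * ((Ψ i).realEval x - (Ψ i).const) := (Ψ i).realEval_smul_sub_const _ _
      have h2 : η i * N < N * ((Ψ i).realEval x - (Ψ i).const) := by
        rw [mul_comm]; exact mul_lt_mul_of_pos_left (hxlin i) hN0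
      have h3 := hNi i
      have h4 := neg_abs_le ((Ψ i).const : ℝ)
      show 0 < (Ψ i).realEval ((N : ℝ) • x)
      linarith
  -- compare volumes
  have hfin : volume ((K ∩ realBox d N) ∩ {x | ∀ i, 0 < (Ψ i).realEval x}) < ⊤ := by
    refine lt_of_le_of_lt (measure_mono fun x hx => hx.1.2) ?_
    unfold realBox
    exact measure_Icc_lt_top
  have hscale : volume ((N : ℝ) • U) = ENNReal.ofReal ((N : ℝ) ^ d) * volume U := by
    rw [Measure.addHaar_smul, Module.finrank_fin_fun, abs_of_nonneg (by positivity)]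
  unfold archFactor
  calc (volume U).toReal * (N : ℝ) ^ d
        = (ENNReal.ofReal ((N : ℝ) ^ d) * volume U).toReal := by
          rw [ENNReal.toReal_mul, ENNReal.toReal_ofReal (by positivity), mul_comm]
    _ = (volume ((N : ℝ) • U)).toReal := by rw [hscale]
    _ ≤ (volume ((K ∩ realBox d N) ∩ {x | ∀ i, 0 < (Ψ i).realEval x})).toReal :=
          ENNReal.toReal_mono hfin.ne (measure_mono hsub)

/-- The prime-point count is at most the size of any finset containing all counted points.
[folklore] -/
private theorem primePointCount_le_card {Ψ : Fin t → AffLinForm d} {K : Set (Fin d → ℝ)} {N : ℕ}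
    {S : Finset (Fin d → ℤ)}
    (h : ∀ n ∈ latticeBox d N, realPoint n ∈ K → (∀ i, ((Ψ i).eval n).toNat.Prime) → n ∈ S) :
    primePointCount Ψ K N ≤ S.card := by
  classical
  unfold primePointCount
  refine Finset.card_le_card fun n hn => ?_
  simp only [Finset.mem_filter] at hn
  exact h n hn.1 hn.2.1 hn.2.2

/-! ### Corollary 1.9 -/

/-- **Green–Tao 2010, Corollary 1.9, at complexity `≤ s` from the Main Theorem at complexity
`≤ s`.** Let `Ψ : ℤ^d → ℤ^t` (`d, t ≥ 1`) have complexity `≤ s`, let `K ⊆ ℝ^d` be an open convex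
cone (open, convex, closed under positive dilations), suppose that for every prime `p` some
`n ∈ ℤ^d` has all `ψᵢ(n)` coprime to `p`, and that some `n ∈ K ∩ ℤ^d` has all `ψ̇ᵢ(n) > 0`. If the
Main Theorem holds at complexity `≤ s`, then infinitely many `n ∈ K ∩ ℤ^d` have `ψ₁(n), …, ψ_t(n)`
all prime. Proof: `∏_p β_p > 0` (`singularProduct_pos_of_locallySolvable`),
`β_∞(K ∩ [−N,N]^d) ≥ c N^d` (`archFactor_inter_realBox_ge_of_cone`), so the counting form (1.8)
gives `≥ (c ∏_p β_p / 4) N^d / logᵗ N → ∞` prime points in `K ∩ [−N, N]^d`.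
[cite: GreenTao2010, Cor. 1.9] -/
theorem GreenTao2010_corollary19_of_mainTheoremAtComplexity {s : ℕ}
    (h : GreenTao2010_mainTheoremAtComplexity s) (hd : 1 ≤ d) (ht : 1 ≤ t)
    (Ψ : Fin t → AffLinForm d) (hc : complexity Ψ ≤ s)
    {K : Set (Fin d → ℝ)} (hKo : IsOpen K) (hKc : Convex ℝ K)
    (hcone : ∀ r : ℝ, 0 < r → ∀ x ∈ K, r • x ∈ K)
    (hloc : ∀ p : ℕ, p.Prime → ∃ n : Fin d → ℤ, ∀ i, ¬ ((p : ℤ) ∣ (Ψ i).eval n))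
    (hpos : ∃ n : Fin d → ℤ, realPoint n ∈ K ∧ ∀ i, 0 < (Ψ i).linearPart n) :
    {n : Fin d → ℤ | realPoint n ∈ K ∧ ∀ i, ((Ψ i).eval n).toNat.Prime}.Infinite := by
  have hfc := isFiniteComplexitySystem_of_complexity_ne_top
    (ne_top_of_le_ne_top (ENat.coe_ne_top s) hc)
  have hΨ : IsNondegenerateSystem Ψ := hfc.1.isNondegenerateSystem hfc.2
  have hS : 0 < singularProduct Ψ := singularProduct_pos_of_locallySolvable Ψ hΨ hloc
  obtain ⟨n₀, hn₀K, hn₀pos⟩ := hpos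
  have hpos' : ∀ i, (Ψ i).const < (Ψ i).realEval (realPoint n₀) := by
    intro i
    rw [realEval_realPoint, AffLinForm.eval_eq_linearPart_add_const]
    push_cast
    have : (0 : ℝ) < ((Ψ i).linearPart n₀ : ℝ) := by exact_mod_cast hn₀pos i
    linarith
  obtain ⟨c, hc0, N₁, hN₁1, hN₁⟩ := archFactor_inter_realBox_ge_of_cone Ψ hKo hcone hn₀K hpos'
  set S : ℝ := singularProduct Ψ with hSdef
  set L : ℕ := ⌈affLinSize Ψ 1⌉₊ with hL
  set ε : ℝ := min (1 / 2) (c * S / 4) with hεdef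
  have hε : 0 < ε := lt_min (by norm_num) (by positivity)
  have hε1 : ε ≤ 1 / 2 := min_le_left _ _
  have hε2 : ε ≤ c * S / 4 := min_le_right _ _
  obtain ⟨N₀, hN₀⟩ := GreenTao2010_primePointCount_of_mainTheoremAtComplexity h d t L hd ht ε hε
  by_contra hinf
  have hfin : {n : Fin d → ℤ | realPoint n ∈ K ∧ ∀ i, ((Ψ i).eval n).toNat.Prime}.Finite :=
    Set.not_infinite.mp hinf
  set M : ℕ := hfin.toFinset.card with hM
  -- growth: eventually `C ≤ log N` and `log^{t+1} N ≤ N`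
  obtain ⟨N₂, hN₂⟩ := eventually_atTop.mp
    (eventually_log_growth t (4 * ((M : ℝ) + 1) / (c * S)) one_pos one_pos one_pos)
  set N : ℕ := max (max N₀ N₁) (max N₂ 2) with hNdef
  have hNN₀ : N₀ ≤ N := le_trans (le_max_left _ _) (le_max_left _ _)
  have hNN₁ : N₁ ≤ N := le_trans (le_max_right _ _) (le_max_left _ _)
  have hNN₂ : N₂ ≤ N := le_trans (le_max_left _ _) (le_max_right _ _)
  have hN2 : 2 ≤ N := le_trans (le_max_right _ _) (le_max_right _ _)
  have hN1 : (1 : ℝ) ≤ N := by exact_mod_cast (show 1 ≤ N by omega)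
  have hN0 : (0 : ℝ) < N := by linarith
  obtain ⟨hlogC, -, hlogpow, -⟩ := hN₂ N hNN₂
  -- the body `K ∩ [−N, N]^d`
  set KN : Set (Fin d → ℝ) := K ∩ realBox d N with hKN
  have hKNc : Convex ℝ KN := hKc.inter (by unfold realBox; exact convex_Icc _ _)
  have hKNsub : KN ⊆ realBox d N := Set.inter_subset_right
  have hLN : affLinSize Ψ N ≤ L :=
    (affLinSize_anti Ψ one_pos hN1).trans (Nat.le_ceil _)
  have main := hN₀ N hNN₀ Ψ hΨ hc hLN KN hKNc hKNsub
  set A : ℝ := archFactor Ψ KN with hA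
  set X : ℝ := (N : ℝ) ^ d with hX
  set T : ℝ := Real.log N ^ t with hT
  set P : ℝ := (primePointCount Ψ KN N : ℝ) with hP
  have hlog : 0 < Real.log N := Real.log_pos (by exact_mod_cast (show 1 < N by omega))
  have hT0 : 0 < T := pow_pos hlog t
  have hX0 : 0 < X := by positivity
  have hAX : c * X ≤ A := hN₁ N hNN₁
  -- lower bound for the count: `P · T ≥ (c S / 4) X`
  have h1 : A * S / T - ε * (A * S + X) / T ≤ P := by
    have := (abs_sub_le_iff.mp main).2
    linarith
  rw [← sub_div, div_le_iff₀ hT0] at h1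
  have h3 : (1 - ε) * (c * X * S) ≤ (1 - ε) * (A * S) :=
    mul_le_mul_of_nonneg_left (mul_le_mul_of_nonneg_right hAX hS.le) (by linarith)
  have h4 : ε * X ≤ (c * S / 4) * X := mul_le_mul_of_nonneg_right hε2 hX0.le
  have h5 : (1 / 2) * (c * X * S) ≤ (1 - ε) * (c * X * S) :=
    mul_le_mul_of_nonneg_right (by linarith) (by positivity)
  have hPT : (c * S / 4) * X ≤ P * T := by linarith
  -- `X ≥ N ≥ log N · T` and `(c S / 4) log N ≥ M + 1`
  have h6 : (N : ℝ) ≤ X := le_self_pow₀ hN1 (by omega)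
  have h7 : Real.log N * T ≤ N := by
    have : Real.log N ^ (t + 1) = T * Real.log N := pow_succ _ _
    linarith [hlogpow]
  have h8 : (c * S / 4) * (Real.log N * T) ≤ (c * S / 4) * X :=
    mul_le_mul_of_nonneg_left (h7.trans h6) (by positivity)
  have h9 : ((M : ℝ) + 1) * T ≤ (c * S / 4 * Real.log N) * T := by
    refine mul_le_mul_of_nonneg_right ?_ hT0.le
    have hcS : 0 < c * S := by positivity
    have : c * S / 4 * (4 * ((M : ℝ) + 1) / (c * S)) = (M : ℝ) + 1 := by
      field_simp
    calc ((M : ℝ) + 1) = c * S / 4 * (4 * ((M : ℝ) + 1) / (c * S)) := this.symm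
      _ ≤ c * S / 4 * Real.log N := mul_le_mul_of_nonneg_left hlogC (by positivity)
  have hMP : ((M : ℝ) + 1) * T ≤ P * T := by linarith
  have hMP' : (M : ℝ) + 1 ≤ P := le_of_mul_le_mul_right hMP hT0
  -- but every counted point lies in the finite set
  have hPM : primePointCount Ψ KN N ≤ M :=
    primePointCount_le_card fun n _ hnK hnp => by
      rw [Set.Finite.mem_toFinset]
      exact ⟨hnK.1, hnp⟩
  have hPM' : P ≤ M := by rw [hP]; exact_mod_cast hPM
  linarith

/-- **Green–Tao 2010, Corollary 1.9 for every system of complexity `≤ 1`, unconditionally**: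
`Ψ : ℤ^d → ℤ^t` (`d, t ≥ 1`) of Cauchy–Schwarz complexity `≤ 1`, `K` an open convex cone, no local
obstruction and a point of `K ∩ ℤ^d` with all `ψ̇ᵢ > 0` ⟹ infinitely many `n ∈ K ∩ ℤ^d` with
`ψ₁(n), …, ψ_t(n)` all prime. [cite: GreenTao2010, Cor. 1.9 (case `s = 1`)] -/
theorem GreenTao2010_corollary19_atComplexity_one (hd : 1 ≤ d) (ht : 1 ≤ t)
    (Ψ : Fin t → AffLinForm d) (hc : complexity Ψ ≤ (1 : ℕ))
    {K : Set (Fin d → ℝ)} (hKo : IsOpen K) (hKc : Convex ℝ K)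
    (hcone : ∀ r : ℝ, 0 < r → ∀ x ∈ K, r • x ∈ K)
    (hloc : ∀ p : ℕ, p.Prime → ∃ n : Fin d → ℤ, ∀ i, ¬ ((p : ℤ) ∣ (Ψ i).eval n))
    (hpos : ∃ n : Fin d → ℤ, realPoint n ∈ K ∧ ∀ i, 0 < (Ψ i).linearPart n) :
    {n : Fin d → ℤ | realPoint n ∈ K ∧ ∀ i, ((Ψ i).eval n).toNat.Prime}.Infinite :=
  GreenTao2010_corollary19_of_mainTheoremAtComplexity GreenTao2010_mainTheoremAtComplexity_one
    hd ht Ψ hc hKo hKc hcone hloc hpos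

end Literature.NumberTheory.Sieve

end
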